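import Summits.ValiantsHypothesis.ValiantsHypothesis.Theorems.KPlusLogSqLawTropicalGradedWalkDomXGlue1

/-!
# Dominance glue (type X), part 5: the block column `b = u + 1`

GRW-lite `K = 4` graded-walk family (census side of the tropical root law, all `m`):
dominance glue for the EXCURSION states `(w, u, 1)`, `2 ≤ u ≤ w − 1 < m − 1`, of the design typed in
`KPlusLogSqLawTropicalGradedWalkDefs` (Leibniz term: the diagonal term of `(w, u, 0)` with the rows of the columns
`u − 1`, `u` exchanged).  This part dispatches an arbitrary rival `(a, u + 1, l)` of the block column `u + 1`
(when `u + 1 < w`; intended incidence: row `m − w + u + 1`, class `1`, level `w`, bend `SXP`) to its slack family of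
`…DomX4` – `…DomX9` (far rivals are first reduced to the best class of their level by the generic lifts of
`…GradedWalkLift`).

Honest framing: this is a census-side (lower-bound) construction — a quadratic family of
distinct optimal slopes for `TropRootLawAt (n+1) 4`.  It says nothing about `TropicalB` inside
its window and nothing about VP ≠ VNP.
-/

set_option linter.dupNamespace false
set_option autoImplicit false

namespace Summit.ValiantsHypothesis.ValiantsHypothesis.Theorems.LacunarySymmetroidMatrixDescartes.TropicalCensus

namespace GradedWalk

open Summit.ValiantsHypothesis.ValiantsHypothesis.Theorems.MatrixDescartes.Negative

variable (n : ℕ)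

/-! ### slack, the block column `b = u + 1` -/

set_option maxHeartbeats 400000 in
/-- slack of the type-X certificate: the block column `b = u + 1`, rival rows above the intended row. -/
theorem slackX_P_hi (w u : ℕ) (hu2 : 2 ≤ u) (huw : u < w) (hwn : w ≤ n) (a b : Fin (n + 1)) (l : Fin 4)
    (hp : ee n a b l ≠ 0) (hbu : (b : ℕ) = u + 1) (hbw : (b : ℕ) < w) (haR : (a : ℕ) < n + 1 - w + (u + 1)) :
    1 * (thX n w u * (dd n l : ℤ) - vv n a b l) <
      UX n w u a + ((thX n w u * (dd n (lam n w u 1 b) : ℤ) - vv n (perm n w u 1 b) b (lam n w u 1 b)) - UX n w u (perm n w u 1 b)) := by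
  have hw1 : w ≤ n + 1 := by omega
  have huw2 : (u + 1) + 1 ≤ w := by omega
  have han : (a : ℕ) ≤ n := Nat.lt_succ_iff.mp a.isLt
  have hr : ((perm n w u 1 b : Fin (n + 1)) : ℕ) = (b : ℕ) + (n + 1 - w) := sigmaX_blk n huw hw1 b hbw (by omega) (by omega)
  rw [hbu] at hr
  rw [lam_X n huw]
  rw [if_neg (show ¬ w ≤ (b : ℕ) by omega), if_neg (show ¬ ((b : ℕ) + 1 < u) by omega),
    if_neg (show ¬ ((b : ℕ) < u) by omega)]
  have hlowr : (b : ℕ) < ((perm n w u 1 b : Fin (n + 1)) : ℕ) := by rw [hr]; omega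
  have hT1 : thX n w u * (dd n 1 : ℤ) - vv n (perm n w u 1 b) b 1 = thX n w u * d1 n - v1 n (w) (u + 1) := by
    rw [dd_cast_one, vv_lower n hlowr, hr, show n + 1 + (b : ℕ) - (u + 1 + (n + 1 - w)) = w by omega, vblk_one, hbu]
  have hUr : UX n w u ((perm n w u 1 b : Fin (n + 1)) : ℕ) = gG n * thX n w u * (((n + 1 - w + (u + 1)) : ℕ) : ℤ) + SXP n w u := by
    rw [hr]; unfold UX; rw [show u + 1 + (n + 1 - w) - (n + 1 - w) = u + 1 by omega, muX_P,
      show u + 1 + (n + 1 - w) = n + 1 - w + (u + 1) by omega]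
  clear hlowr
  rcases Nat.lt_or_ge (a : ℕ) (b : ℕ) with hab | hba
  · -- wrap cells above the diagonal: classes 0 / 1
    have hl : l = 0 ∨ l = 1 := by
      rcases (show l = 0 ∨ l = 1 ∨ l = 2 ∨ l = 3 by fin_cases l <;> simp) with rfl | rfl | rfl | rfl
      · exact Or.inl rfl
      · exact Or.inr rfl
      · exact absurd (ee_upper_ge_two n hab 2 (by decide)) hp
      · exact absurd (ee_upper_ge_two n hab 3 (by decide)) hp
    -- the row regimes: `a = 0`; pre-block `a ≤ u − 1` / `a = u`; block (`m − w ≥ 2`) ; block with `w = n` (`a ≤ u − 1` / `a = u`)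
    rcases hl with rfl | rfl
    · have hXg : ∀ x : ℕ, (a : ℕ) = x → thX n w u * (dd n 0 : ℤ) - vv n a b 0 = ((0 : ℤ) - 4 * mZ n * gG n ^ 2 * ((((u + 1) - (x)) : ℕ) : ℤ) ^ 2) := by
        intro x hx
        have hc : (((((u + 1)) - (x) : ℕ)) : ℤ) = (((b : ℕ)) : ℤ) - (((a : ℕ)) : ℤ) := by
          rw [hbu, hx]; push_cast [Nat.cast_sub (show x ≤ u + 1 by omega)]; ring
        rw [dd_cast_zero, vv_upper_zero n hab, hc]; ring
      rcases Nat.eq_zero_or_pos (a : ℕ) with ha0 | ha0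
      · have hY : UX n w u a - UX n w u ((perm n w u 1 b : Fin (n + 1)) : ℕ) = ((0 : ℤ) - (gG n * thX n w u * (((n + 1 - w + (u + 1)) : ℕ) : ℤ) + SXP n w u)) := by
          rw [hUr]; unfold UX; rw [ha0, Nat.zero_sub, muX_zero n hu2]; simp
        exact slack_of (X_P_w0_R0 n w u hu2 huw2 hwn) (hXg 0 ha0) hT1 hY
      · rcases Nat.lt_or_ge (n + 1 - w) (a : ℕ) with hblk | hpl
        · obtain ⟨jp, hjp⟩ : ∃ jp, (a : ℕ) = (n + 1 - w) + jp := ⟨(a : ℕ) - (n + 1 - w), by omega⟩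
          rcases Nat.lt_or_ge 1 (n + 1 - w) with hd2 | hd1
          · have hY : UX n w u a - UX n w u ((perm n w u 1 b : Fin (n + 1)) : ℕ) = ((gG n * thX n w u * ((((n + 1 - w) + (jp)) : ℕ) : ℤ) + SX2 n w u (jp)) - (gG n * thX n w u * (((n + 1 - w + (u + 1)) : ℕ) : ℤ) + SXP n w u)) := by
              rw [hUr]; unfold UX; rw [show (a : ℕ) - (n + 1 - w) = jp by omega, muX_lt n (by omega), hjp]
            exact slack_of (X_P_w0_Blt n w u jp ((n + 1 - w)) (by omega) (by omega) (by omega) huw2 (by omega)) (hXg _ hjp) hT1 hY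
          · have hnw : n = w := by omega
            rcases Nat.lt_or_ge (a : ℕ) u with hau | hau
            · have hY : UX n w u a - UX n w u ((perm n w u 1 b : Fin (n + 1)) : ℕ) = ((gG n * thX n w u * (((1 + (jp)) : ℕ) : ℤ) + SX2 n w u (jp)) - (gG n * thX n w u * (((n + 1 - w + (u + 1)) : ℕ) : ℤ) + SXP n w u)) := by
                rw [hUr]; unfold UX; rw [show (a : ℕ) - (n + 1 - w) = jp by omega, muX_lt n (by omega), show (a : ℕ) = 1 + jp by omega]
              exact slack_of (X_P_w0_Blt1 n w u jp (by omega) (by omega) huw2 hnw) (hXg _ (by omega)) hT1 hY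
            · have hY : UX n w u a - UX n w u ((perm n w u 1 b : Fin (n + 1)) : ℕ) = ((gG n * thX n w u * (((1 + (u - 1)) : ℕ) : ℤ) + SXR1 n w u) - (gG n * thX n w u * (((n + 1 - w + (u + 1)) : ℕ) : ℤ) + SXP n w u)) := by
                rw [hUr]; unfold UX; rw [show (a : ℕ) - (n + 1 - w) = u - 1 by omega, muX_R1 n (by omega), show (a : ℕ) = 1 + (u - 1) by omega]
              exact slack_of (X_P_w0_BR1 n w u hu2 huw2 hnw) (hXg _ (by omega)) hT1 hY
        · rcases Nat.lt_or_ge (a : ℕ) u with hau | hau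
          · have hY : UX n w u a - UX n w u ((perm n w u 1 b : Fin (n + 1)) : ℕ) = (gG n * thX n w u * (((a) : ℕ) : ℤ) - (gG n * thX n w u * (((n + 1 - w + (u + 1)) : ℕ) : ℤ) + SXP n w u)) := by
              rw [hUr]; unfold UX; rw [show (a : ℕ) - (n + 1 - w) = 0 by omega, muX_zero n hu2]; simp
            exact slack_of (X_P_w0_P1 n w u a (by omega) (by omega) huw2 (by omega)) (hXg _ rfl) hT1 hY
          · have hY : UX n w u a - UX n w u ((perm n w u 1 b : Fin (n + 1)) : ℕ) = (gG n * thX n w u * (((u) : ℕ) : ℤ) - (gG n * thX n w u * (((n + 1 - w + (u + 1)) : ℕ) : ℤ) + SXP n w u)) := by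
              rw [hUr]; unfold UX; rw [show (a : ℕ) - (n + 1 - w) = 0 by omega, muX_zero n hu2, show (a : ℕ) = u by omega]; simp
            exact slack_of (X_P_w0_P2 n w u hu2 huw2 (by omega)) (hXg _ (by omega)) hT1 hY
    · have hXg : ∀ x : ℕ, (a : ℕ) = x → thX n w u * (dd n 1 : ℤ) - vv n a b 1 = (thX n w u * d1 n - conn n (((u + 1)) - (x)) ((u + 1))) := by
        intro x hx
        rw [dd_cast_one, vv_upper_one n hab, hx, hbu]
      rcases Nat.eq_zero_or_pos (a : ℕ) with ha0 | ha0
      · have hY : UX n w u a - UX n w u ((perm n w u 1 b : Fin (n + 1)) : ℕ) = ((0 : ℤ) - (gG n * thX n w u * (((n + 1 - w + (u + 1)) : ℕ) : ℤ) + SXP n w u)) := by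
          rw [hUr]; unfold UX; rw [ha0, Nat.zero_sub, muX_zero n hu2]; simp
        exact slack_of (X_P_cn_R0 n w u hu2 huw2 hwn) (hXg 0 ha0) hT1 hY
      · rcases Nat.lt_or_ge (n + 1 - w) (a : ℕ) with hblk | hpl
        · obtain ⟨jp, hjp⟩ : ∃ jp, (a : ℕ) = (n + 1 - w) + jp := ⟨(a : ℕ) - (n + 1 - w), by omega⟩
          rcases Nat.lt_or_ge 1 (n + 1 - w) with hd2 | hd1
          · have hY : UX n w u a - UX n w u ((perm n w u 1 b : Fin (n + 1)) : ℕ) = ((gG n * thX n w u * ((((n + 1 - w) + (jp)) : ℕ) : ℤ) + SX2 n w u (jp)) - (gG n * thX n w u * (((n + 1 - w + (u + 1)) : ℕ) : ℤ) + SXP n w u)) := by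
              rw [hUr]; unfold UX; rw [show (a : ℕ) - (n + 1 - w) = jp by omega, muX_lt n (by omega), hjp]
            exact slack_of (X_P_cn_Blt n w u jp ((n + 1 - w)) (by omega) (by omega) (by omega) huw2 (by omega)) (hXg _ hjp) hT1 hY
          · have hnw : n = w := by omega
            rcases Nat.lt_or_ge (a : ℕ) u with hau | hau
            · have hY : UX n w u a - UX n w u ((perm n w u 1 b : Fin (n + 1)) : ℕ) = ((gG n * thX n w u * (((1 + (jp)) : ℕ) : ℤ) + SX2 n w u (jp)) - (gG n * thX n w u * (((n + 1 - w + (u + 1)) : ℕ) : ℤ) + SXP n w u)) := by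
                rw [hUr]; unfold UX; rw [show (a : ℕ) - (n + 1 - w) = jp by omega, muX_lt n (by omega), show (a : ℕ) = 1 + jp by omega]
              exact slack_of (X_P_cn_Blt1 n w u jp (by omega) (by omega) huw2 hnw) (hXg _ (by omega)) hT1 hY
            · have hY : UX n w u a - UX n w u ((perm n w u 1 b : Fin (n + 1)) : ℕ) = ((gG n * thX n w u * (((1 + (u - 1)) : ℕ) : ℤ) + SXR1 n w u) - (gG n * thX n w u * (((n + 1 - w + (u + 1)) : ℕ) : ℤ) + SXP n w u)) := by
                rw [hUr]; unfold UX; rw [show (a : ℕ) - (n + 1 - w) = u - 1 by omega, muX_R1 n (by omega), show (a : ℕ) = 1 + (u - 1) by omega]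
              exact slack_of (X_P_cn_BR1 n w u hu2 huw2 hnw) (hXg _ (by omega)) hT1 hY
        · rcases Nat.lt_or_ge (a : ℕ) u with hau | hau
          · have hY : UX n w u a - UX n w u ((perm n w u 1 b : Fin (n + 1)) : ℕ) = (gG n * thX n w u * (((a) : ℕ) : ℤ) - (gG n * thX n w u * (((n + 1 - w + (u + 1)) : ℕ) : ℤ) + SXP n w u)) := by
              rw [hUr]; unfold UX; rw [show (a : ℕ) - (n + 1 - w) = 0 by omega, muX_zero n hu2]; simp
            exact slack_of (X_P_cn_P1 n w u a (by omega) (by omega) huw2 (by omega)) (hXg _ rfl) hT1 hY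
          · have hY : UX n w u a - UX n w u ((perm n w u 1 b : Fin (n + 1)) : ℕ) = (gG n * thX n w u * (((u) : ℕ) : ℤ) - (gG n * thX n w u * (((n + 1 - w + (u + 1)) : ℕ) : ℤ) + SXP n w u)) := by
              rw [hUr]; unfold UX; rw [show (a : ℕ) - (n + 1 - w) = 0 by omega, muX_zero n hu2, show (a : ℕ) = u by omega]; simp
            exact slack_of (X_P_cn_P2 n w u hu2 huw2 (by omega)) (hXg _ (by omega)) hT1 hY
  -- between the diagonal (included) and the intended row (excluded): future levels `w + k`, class 1 best; or the diagonal class-0 cell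
  obtain ⟨k, hk⟩ : ∃ k, (a : ℕ) + k = n + 1 - w + (u + 1) := ⟨n + 1 - w + (u + 1) - (a : ℕ), by omega⟩
  have hk1 : 1 ≤ k := by omega
  have hkle : k ≤ n + 1 - w := by omega
  have hkle' : k ≤ (u + 1) + (n + 1 - w) := by omega
  have hak : (a : ℕ) = (u + 1) + (n + 1 - w) - k := by omega
  rcases Nat.eq_or_lt_of_le hba with hab | hab
  · -- diagonal (`k = m − w`)
    have hab' : (a : ℕ) = (b : ℕ) := hab.symm
    have hkq : n + 1 = k + w := by omega
    by_cases hcl : l = 0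
    · subst hcl
      have hX0 : thX n w u * (dd n 0 : ℤ) - vv n a b 0 = thX n w u * 0 - 0 := by rw [dd_cast_zero, vv_diag_zero n hab']
      rcases Nat.lt_or_ge (u + 1) (k + 1) with hku | hku
      · -- pre-block diagonal row
        have hY : UX n w u a - UX n w u ((perm n w u 1 b : Fin (n + 1)) : ℕ) = (gG n * thX n w u * (((u + 1) : ℕ) : ℤ) - (gG n * thX n w u * (((n + 1 - w + (u + 1)) : ℕ) : ℤ) + SXP n w u)) := by
          rw [hUr, hab', hbu]; unfold UX; rw [show (u + 1) - (n + 1 - w) = 0 by omega, muX_zero n hu2]; ring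
        exact slack_of (X_P_dg0_P n w u hu2 huw2 (by omega)) hX0 hT1 hY
      · rcases Nat.lt_or_ge k 3 with hk3 | hk3
        · rcases Nat.lt_or_ge k 2 with hk2 | hk2
          · -- `k = 1` (`w = n`): the diagonal row is `R₂`
            have hnw : n = w := by omega
            have hY : UX n w u a - UX n w u ((perm n w u 1 b : Fin (n + 1)) : ℕ) = ((gG n * thX n w u * (((1 + (u)) : ℕ) : ℤ) + SXR2 n w u) - (gG n * thX n w u * (((n + 1 - w + (u + 1)) : ℕ) : ℤ) + SXP n w u)) := by
              rw [hUr, hab', hbu]; unfold UX; rw [show (u + 1) - (n + 1 - w) = u by omega, muX_R2, show u + 1 = 1 + u by omega]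
            exact slack_of (X_P_dg0_BR2 n w u hu2 huw2 hnw) hX0 hT1 hY
          · -- `k = 2` (`w + 1 = n`): the diagonal row is `R₁`
            have hnw : n = w + 1 := by omega
            obtain ⟨jp, hjp⟩ : ∃ jp, u = jp + 1 := ⟨u - 1, by omega⟩
            subst hjp
            have hY : UX n w (jp + 1) a - UX n w (jp + 1) ((perm n w (jp + 1) 1 b : Fin (n + 1)) : ℕ) = ((gG n * thX n w (jp + 1) * (((2 + (jp)) : ℕ) : ℤ) + SXR1 n w (jp + 1)) - (gG n * thX n w (jp + 1) * (((n + 1 - w + ((jp + 1) + 1)) : ℕ) : ℤ) + SXP n w (jp + 1))) := by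
              rw [hUr, hab', hbu]; unfold UX; rw [show (jp + 1 + 1) - (n + 1 - w) = jp by omega, muX_R1 n rfl, show jp + 1 + 1 = 2 + jp by omega]
            exact slack_of (X_P_dg0_BR1 n w jp (by omega) (by omega) hnw) hX0 hT1 hY
        · -- `3 ≤ k ≤ u + 1`: bend regime `SX2`
          obtain ⟨jp, hjp⟩ : ∃ jp, u = (n + 1 - w) + jp - 1 := ⟨u + 1 - (n + 1 - w), by omega⟩
          have hjp1 : 1 ≤ jp := by omega
          subst hjp
          have hY : UX n w ((n + 1 - w) + jp - 1) a - UX n w ((n + 1 - w) + jp - 1) ((perm n w ((n + 1 - w) + jp - 1) 1 b : Fin (n + 1)) : ℕ) =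
              ((gG n * thX n w ((n + 1 - w) + jp - 1) * ((((n + 1 - w) + (jp)) : ℕ) : ℤ) + SX2 n w ((n + 1 - w) + jp - 1) (jp)) -
                (gG n * thX n w ((n + 1 - w) + jp - 1) * (((n + 1 - w + (((n + 1 - w) + jp - 1) + 1)) : ℕ) : ℤ) + SXP n w ((n + 1 - w) + jp - 1))) := by
            rw [hUr, hab', hbu]; unfold UX
            rw [show (n + 1 - w) + jp - 1 + 1 - (n + 1 - w) = jp by omega, muX_lt n (by omega), show (n + 1 - w) + jp - 1 + 1 = (n + 1 - w) + jp by omega]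
          exact slack_of (X_P_dg0_Blt n w jp ((n + 1 - w)) hjp1 (by omega) (by omega) (by omega)) hX0 hT1 hY
    · have hθ : thX n w u ≤ LL n * ((n : ℤ) + 1) := thX_le_top n huw hwn
      have hX1 : thX n w u * (dd n 1 : ℤ) - vv n a b 1 = thX n w u * d1 n - v1 n (n + 1) (u + 1) := by
        rw [dd_cast_one, vv_diag n hab' 1 (by decide), vblk_one, hbu]
      have hXl : thX n w u * (dd n l : ℤ) - vv n a b l + 1 ≤ thX n w u * d1 n - v1 n (n + 1) (u + 1) + 1 ∨ l = 1 := by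
        rcases (show l = 0 ∨ l = 1 ∨ l = 2 ∨ l = 3 by fin_cases l <;> simp) with rfl | rfl | rfl | rfl
        · exact absurd rfl hcl
        · exact Or.inr rfl
        · left; rw [dd_cast_two, vv_diag n hab' 2 (by decide), vblk_two, hbu]
          linarith [lift_fut2_top n (θ := thX n w u) (u + 1) hθ]
        · left; rw [dd_cast_three, vv_diag n hab' 3 (by decide), vblk_three, hbu]
          linarith [lift_fut3_top n (θ := thX n w u) (u + 1) hθ]
      have hXl : thX n w u * (dd n l : ℤ) - vv n a b l ≤ thX n w u * d1 n - v1 n (n + 1) (u + 1) := by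
        rcases hXl with h | rfl
        · linarith
        · exact le_of_eq hX1
      clear hX1 hθ
      rcases Nat.lt_or_ge (u + 1) k with hku | hku
      · -- pre-block diagonal row (`u + 2 ≤ k`)
        have hY : UX n w u a - UX n w u ((perm n w u 1 b : Fin (n + 1)) : ℕ) = (gG n * thX n w u * (((n + 1 - w + u + 1 - k) : ℕ) : ℤ) - (gG n * thX n w u * (((n + 1 - w + (u + 1)) : ℕ) : ℤ) + SXP n w u)) := by
          rw [hUr]; unfold UX; rw [show (a : ℕ) - (n + 1 - w) = 0 by omega, muX_zero n hu2, show (a : ℕ) = n + 1 - w + u + 1 - k by omega]; ring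
        exact slack_le (X_P_up_Pl_m n w u k hu2 (by omega) huw2 hkq) hXl hT1 hY
      · rcases Nat.lt_or_ge k 3 with hk3 | hk3
        · rcases Nat.lt_or_ge k 2 with hk2 | hk2
          · have hkone : k = 1 := by omega
            subst hkone
            have hY : UX n w u a - UX n w u ((perm n w u 1 b : Fin (n + 1)) : ℕ) = ((-(gG n * thX n w u * ((1 : ℕ) : ℤ))) + (SXR2 n w u - SXP n w u)) := by
              rw [hUr]; unfold UX; rw [show (a : ℕ) - (n + 1 - w) = u by omega, muX_R2, hak]; push_cast [Nat.cast_sub hkle', Nat.cast_sub hw1]; ring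
            exact slack_le (X_P_up_R2_m n w u hu2 huw2 (by omega)) hXl hT1 hY
          · have hktwo : k = 2 := by omega
            subst hktwo
            have hY : UX n w u a - UX n w u ((perm n w u 1 b : Fin (n + 1)) : ℕ) = ((-(gG n * thX n w u * ((2 : ℕ) : ℤ))) + (SXR1 n w u - SXP n w u)) := by
              rw [hUr]; unfold UX; rw [show (a : ℕ) - (n + 1 - w) = u - 1 by omega, muX_R1 n (by omega), hak]; push_cast [Nat.cast_sub hkle', Nat.cast_sub hw1]; ring
            exact slack_le (X_P_up_R1_m n w u hu2 huw2 (by omega)) hXl hT1 hY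
        · have hY : UX n w u a - UX n w u ((perm n w u 1 b : Fin (n + 1)) : ℕ) = ((-(gG n * thX n w u * ((k : ℕ) : ℤ))) + (SX2 n w u (u + 1 - k) - SXP n w u)) := by
            rw [hUr]; unfold UX; rw [show (a : ℕ) - (n + 1 - w) = u + 1 - k by omega, muX_lt n (by omega), hak]; push_cast [Nat.cast_sub hkle', Nat.cast_sub hw1]; ring
          exact slack_le (X_P_up_A_m n w u k hk3 (by omega) huw2 hkq) hXl hT1 hY
  · -- strictly between: level `w + k ≤ n`
    have hlow : (b : ℕ) < (a : ℕ) := hab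
    have hEa : n + 1 + (b : ℕ) - (a : ℕ) = w + k := by omega
    have hne1 : w + k ≠ n + 1 := by omega
    have hkn : k + w ≤ n := by omega
    have hθ : thX n w u ≤ LL n * ((w + k : ℕ) : ℤ) := thX_le_LE n huw hwn (by omega)
    have hcl : l ≠ 0 := fun h0 => by subst h0; exact hp (ee_lower_zero n hlow)
    have hX1 : thX n w u * (dd n 1 : ℤ) - vv n a b 1 = thX n w u * d1 n - v1 n (w + k) (u + 1) := by
      rw [dd_cast_one, vv_lower n hlow, hEa, vblk_one, hbu]
    have hXl : thX n w u * (dd n l : ℤ) - vv n a b l + 1 ≤ thX n w u * d1 n - v1 n (w + k) (u + 1) + 1 ∨ l = 1 := by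
      rcases (show l = 0 ∨ l = 1 ∨ l = 2 ∨ l = 3 by fin_cases l <;> simp) with rfl | rfl | rfl | rfl
      · exact absurd rfl hcl
      · exact Or.inr rfl
      · left; rw [dd_cast_two, vv_lower n hlow, hEa, vblk_two, tau2_of_ne n hne1, hbu]
        linarith [lift_fut2 n (θ := thX n w u) (E := w + k) (u + 1) hθ]
      · left; rw [dd_cast_three, vv_lower n hlow, hEa, vblk_three, tau2_of_ne n hne1, tau3_of_ne n hne1, hbu]
        linarith [lift_fut3 n (θ := thX n w u) (E := w + k) (u + 1) hθ]
    have hXl : thX n w u * (dd n l : ℤ) - vv n a b l ≤ thX n w u * d1 n - v1 n (w + k) (u + 1) := by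
      rcases hXl with h | rfl
      · linarith
      · exact le_of_eq hX1
    clear hX1 hEa hne1 hθ
    rcases Nat.lt_or_ge (u + 1) k with hku | hku
    · have hY : UX n w u a - UX n w u ((perm n w u 1 b : Fin (n + 1)) : ℕ) = (gG n * thX n w u * (((n + 1 - w + u + 1 - k) : ℕ) : ℤ) - (gG n * thX n w u * (((n + 1 - w + (u + 1)) : ℕ) : ℤ) + SXP n w u)) := by
        rw [hUr]; unfold UX; rw [show (a : ℕ) - (n + 1 - w) = 0 by omega, muX_zero n hu2, show (a : ℕ) = n + 1 - w + u + 1 - k by omega]; ring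
      exact slack_le (X_P_up_Pl_lt n w u k hu2 (by omega) huw2 hkn) hXl hT1 hY
    · rcases Nat.lt_or_ge k 3 with hk3 | hk3
      · rcases Nat.lt_or_ge k 2 with hk2 | hk2
        · have hkone : k = 1 := by omega
          subst hkone
          have hY : UX n w u a - UX n w u ((perm n w u 1 b : Fin (n + 1)) : ℕ) = ((-(gG n * thX n w u * ((1 : ℕ) : ℤ))) + (SXR2 n w u - SXP n w u)) := by
            rw [hUr]; unfold UX; rw [show (a : ℕ) - (n + 1 - w) = u by omega, muX_R2, hak]; push_cast [Nat.cast_sub hkle', Nat.cast_sub hw1]; ring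
          exact slack_le (X_P_up_R2_lt n w u hu2 huw2 (by omega)) hXl hT1 hY
        · have hktwo : k = 2 := by omega
          subst hktwo
          have hY : UX n w u a - UX n w u ((perm n w u 1 b : Fin (n + 1)) : ℕ) = ((-(gG n * thX n w u * ((2 : ℕ) : ℤ))) + (SXR1 n w u - SXP n w u)) := by
            rw [hUr]; unfold UX; rw [show (a : ℕ) - (n + 1 - w) = u - 1 by omega, muX_R1 n (by omega), hak]; push_cast [Nat.cast_sub hkle', Nat.cast_sub hw1]; ring
          exact slack_le (X_P_up_R1_lt n w u hu2 huw2 (by omega)) hXl hT1 hY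
      · have hY : UX n w u a - UX n w u ((perm n w u 1 b : Fin (n + 1)) : ℕ) = ((-(gG n * thX n w u * ((k : ℕ) : ℤ))) + (SX2 n w u (u + 1 - k) - SXP n w u)) := by
          rw [hUr]; unfold UX; rw [show (a : ℕ) - (n + 1 - w) = u + 1 - k by omega, muX_lt n (by omega), hak]; push_cast [Nat.cast_sub hkle', Nat.cast_sub hw1]; ring
        exact slack_le (X_P_up_A_lt n w u k hk3 (by omega) huw2 hkn) hXl hT1 hY

set_option maxHeartbeats 400000 in
/-- slack of the type-X certificate: the block column `b = u + 1`, rival rows at or below the intended row. -/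
theorem slackX_P_lo (w u : ℕ) (hu2 : 2 ≤ u) (huw : u < w) (hwn : w ≤ n) (a b : Fin (n + 1)) (l : Fin 4)
    (hp : ee n a b l ≠ 0) (hne : perm n w u 1 b ≠ a ∨ lam n w u 1 b ≠ l) (hbu : (b : ℕ) = u + 1) (hbw : (b : ℕ) < w)
    (haR : n + 1 - w + (u + 1) ≤ (a : ℕ)) :
    1 * (thX n w u * (dd n l : ℤ) - vv n a b l) <
      UX n w u a + ((thX n w u * (dd n (lam n w u 1 b) : ℤ) - vv n (perm n w u 1 b) b (lam n w u 1 b)) - UX n w u (perm n w u 1 b)) := by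
  have hw1 : w ≤ n + 1 := by omega
  have huw2 : (u + 1) + 1 ≤ w := by omega
  have han : (a : ℕ) ≤ n := Nat.lt_succ_iff.mp a.isLt
  have hr : ((perm n w u 1 b : Fin (n + 1)) : ℕ) = (b : ℕ) + (n + 1 - w) := sigmaX_blk n huw hw1 b hbw (by omega) (by omega)
  rw [hbu] at hr
  rw [lam_X n huw] at hne ⊢
  rw [if_neg (show ¬ w ≤ (b : ℕ) by omega), if_neg (show ¬ ((b : ℕ) + 1 < u) by omega),
    if_neg (show ¬ ((b : ℕ) < u) by omega)] at hne ⊢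
  have hlowr : (b : ℕ) < ((perm n w u 1 b : Fin (n + 1)) : ℕ) := by rw [hr]; omega
  have hwne : w ≠ n + 1 := by omega
  have hT1 : thX n w u * (dd n 1 : ℤ) - vv n (perm n w u 1 b) b 1 = thX n w u * d1 n - v1 n (w) (u + 1) := by
    rw [dd_cast_one, vv_lower n hlowr, hr, show n + 1 + (b : ℕ) - (u + 1 + (n + 1 - w)) = w by omega, vblk_one, hbu]
  have hUr : UX n w u ((perm n w u 1 b : Fin (n + 1)) : ℕ) = gG n * thX n w u * (((n + 1 - w + (u + 1)) : ℕ) : ℤ) + SXP n w u := by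
    rw [hr]; unfold UX; rw [show u + 1 + (n + 1 - w) - (n + 1 - w) = u + 1 by omega, muX_P,
      show u + 1 + (n + 1 - w) = n + 1 - w + (u + 1) by omega]
  clear hlowr
  have hlow : (b : ℕ) < (a : ℕ) := by omega
  have hcl : l ≠ 0 := fun h0 => by subst h0; exact hp (ee_lower_zero n hlow)
  rcases Nat.eq_or_lt_of_le haR with haR1 | hagt
  · -- class rivals at the intended cell (level `w`)
    have hrot : perm n w u 1 b = a := Fin.ext (by rw [hr]; omega)
    have hY : UX n w u a - UX n w u ((perm n w u 1 b : Fin (n + 1)) : ℕ) = 0 := by rw [hrot]; ring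
    have hEa : n + 1 + (b : ℕ) - (a : ℕ) = w := by omega
    rcases (show l = 0 ∨ l = 1 ∨ l = 2 ∨ l = 3 by fin_cases l <;> simp) with rfl | rfl | rfl | rfl
    · exact absurd rfl hcl
    · exact absurd rfl (hne.resolve_left (fun h => h hrot))
    · have hX : thX n w u * (dd n 2 : ℤ) - vv n a b 2 = thX n w u * d2 n - (v1 n (w) (u + 1) + bB n * tau2lt n (w) (u + 1)) := by
        rw [dd_cast_two, vv_lower n hlow, hEa, vblk_two, tau2_of_ne n hwne, hbu]
      exact slack_of0 (X_P_cls_l2 n w u hu2 huw2 hwn) hX hT1 hY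
    · have hX : thX n w u * (dd n 3 : ℤ) - vv n a b 3 = thX n w u * d3 n - ((v1 n (w) (u + 1) + bB n * tau2lt n (w) (u + 1)) + tau3lt n (w) (u + 1)) := by
        rw [dd_cast_three, vv_lower n hlow, hEa, vblk_three, tau2_of_ne n hwne, tau3_of_ne n hwne, hbu]
      exact slack_of0 (X_P_cls_l3 n w u hu2 huw2 hwn) hX hT1 hY
  · -- below the intended cell: past levels `w − k`, class 3 best
    obtain ⟨k, hk⟩ : ∃ k, (a : ℕ) = (n + 1 - w + (u + 1)) + k := ⟨(a : ℕ) - (n + 1 - w + (u + 1)), by omega⟩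
    have hk1 : 1 ≤ k := by clear hT1 hUr hr; omega
    have hkw : (k + (u + 1)) + 1 ≤ w := by clear hT1 hUr hr; omega
    have hEa : n + 1 + (b : ℕ) - (a : ℕ) = w - k := by clear hT1 hUr hr; omega
    have hne3 : w - k ≠ n + 1 := by clear hT1 hUr hr hEa; omega
    have hcn : u + 1 ≤ n := by clear hT1 hUr hr hEa hne3; omega
    have hEn : w - k ≤ n := by clear hT1 hUr hr hEa hne3; omega
    have hj : (a : ℕ) - (n + 1 - w) = u + 1 + k := by clear hT1 hUr hr hEa hne3 hcn hEn; omega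
    have huk : u + 2 ≤ u + 1 + k := by clear hT1 hUr hr hEa hne3 hcn hEn hj; omega
    have hθ : LL n * ((w - k : ℕ) + 1) ≤ thX n w u :=
      LE_le_thX n u (by clear hT1 hUr hr hEa hne3 hcn hEn hj; omega)
    have hX3 : thX n w u * (dd n 3 : ℤ) - vv n a b 3 = thX n w u * d3 n - ((v1 n (w - k) (u + 1) + bB n * tau2lt n (w - k) (u + 1)) + tau3lt n (w - k) (u + 1)) := by
      rw [dd_cast_three, vv_lower n hlow, hEa, vblk_three, tau2_of_ne n hne3, tau3_of_ne n hne3, hbu]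
    have hlift : thX n w u * (dd n l : ℤ) - vv n a b l + (if l = 3 then 0 else 1) ≤ thX n w u * d3 n - ((v1 n (w - k) (u + 1) + bB n * tau2lt n (w - k) (u + 1)) + tau3lt n (w - k) (u + 1)) := by
      rcases (show l = 0 ∨ l = 1 ∨ l = 2 ∨ l = 3 by fin_cases l <;> simp) with rfl | rfl | rfl | rfl
      · exact absurd rfl hcl
      · rw [dd_cast_one, vv_lower n hlow, hEa, vblk_one, hbu]
        simp only [show ((1 : Fin 4) = 3) = False by decide, ite_false]
        linarith [lift_past1 n (θ := thX n w u) (c := u + 1) (E := w - k) hcn hEn hθ]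
      · rw [dd_cast_two, vv_lower n hlow, hEa, vblk_two, tau2_of_ne n hne3, hbu]
        simp only [show ((2 : Fin 4) = 3) = False by decide, ite_false]
        linarith [lift_past2 n (θ := thX n w u) (c := u + 1) (E := w - k) hcn hEn hθ]
      · rw [hX3]; simp
    clear hX3 hEa hne3 hcn hEn hθ
    have hY : UX n w u a - UX n w u ((perm n w u 1 b : Fin (n + 1)) : ℕ) = (gG n * thX n w u * ((k : ℕ) : ℤ) + (SXL n w u (u + 1 + k) - SXP n w u)) := by
      rw [hUr]; unfold UX; rw [hj, muX_ge n huk, hk]; push_cast [Nat.cast_sub hw1]; ring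
    have hF := X_P_down n w u k hu2 hk1 hkw hwn
    exact slack_of (lift_combine hlift hF) rfl hT1 hY

/-- slack of the type-X certificate: the block column `b = u + 1` (`u + 1 < w`). -/
theorem slackX_P (w u : ℕ) (hu2 : 2 ≤ u) (huw : u < w) (hwn : w ≤ n) (a b : Fin (n + 1)) (l : Fin 4)
    (hp : ee n a b l ≠ 0) (hne : perm n w u 1 b ≠ a ∨ lam n w u 1 b ≠ l) (hbu : (b : ℕ) = u + 1) (hbw : (b : ℕ) < w) :
    1 * (thX n w u * (dd n l : ℤ) - vv n a b l) <
      UX n w u a + ((thX n w u * (dd n (lam n w u 1 b) : ℤ) - vv n (perm n w u 1 b) b (lam n w u 1 b)) - UX n w u (perm n w u 1 b)) := by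
  rcases Nat.lt_or_ge (a : ℕ) (n + 1 - w + (u + 1)) with h | h
  · exact slackX_P_hi n w u hu2 huw hwn a b l hp hbu hbw h
  · exact slackX_P_lo n w u hu2 huw hwn a b l hp hne hbu hbw h

end GradedWalk

end Summit.ValiantsHypothesis.ValiantsHypothesis.Theorems.LacunarySymmetroidMatrixDescartes.TropicalCensus
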